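import Summits.QuantumFields.YangMills.Theorems.UnitScaleTiltProp7ClosedFibreMinimiser
import HarnessLib

/-!
# Route `UnitScaleTilt`, crux K1 «MinimiserStabilityRegPr» (stmt-QuantumFields-19200, skeleton v10), route (β) for the stub `stub_existenceMinimalOrbit` — **THE INTERIORITY
# SENTENCE SPLIT INTO ITS PLAQUETTE HALF AND ITS DIVERGENCE HALF ON A RADIUS WINDOW, AND EX FROM THE TWO HALVES AT `O₁ = 1`**

Cell `ym3-torus` (HUMAN RULING D-0037, YM ladder rung R3), width seat `ym-ust-20520-w4` (g0) — by-name glue for the OWNER's (β) division of labour (RECORD 01:18:38Z: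
19200-w4 owns the INTERIOR sentence; 20520-w2 g2 the PLAQUETTE half «minimiser ⇒ plaquette bound strict»; 20520-w5 g0 the AXIAL∕DIVERGENCE half «small divergence strict at a
minimiser»).  THEOREMS ONLY (0 `def`, 0 `sorry`, standard axioms).  Companion of `UnitScaleTiltProp7ClosedFibreMinimiser` (p591314).

The two halves are stated on a RADIUS WINDOW `L³B₃ε₁ ≤ e ≤ e₆` (19200-w4's phrasing), for minimisers `Ū` of the Wilson action (5) over the two-clause closed fibre
`(6̄)(e) ∩ 𝔅_k(V)` of the sibling, (7)-data `V` (`|V(∂p) − 1| < ε₁`, `0 < ε₁ ≤ a′₁`) carrying a background `U₀ ∈ 𝔘_k(L³B₃ε₁) ∩ 𝔅_k(V)` ((14), `C₁ = L³`):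
* PLAQ(L, B₃; e₆, a′₁): `… ⇒ PlaqSmall (regThreshold F n K e) Ū` (every plaquette variable STRICTLY inside the shell `eL^{−2(K−n)}`);
* DIV(L, B₃; e₆, a′₁):  `… ⇒ DivSmall F n K e Ū` (every covariant divergence (1.2) STRICTLY inside `eL^{−3(K−n)}`).
§1 `regPr_of_plaqHalf_divHalf` (member level, one radius): PLAQ ∧ DIV at `e` ⇒ `RegPr F n K e Ū` — the sibling's INTERIOR conclusion.  §2 ★★
`existenceMinimalOrbit_of_plaqHalf_divHalf_allL : PLAQ_allL → DIV_allL → ⟨v10 `stub_existenceMinimalOrbit` TEXT VERBATIM⟩` — both halves read at the bottom of the window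
`e := L³B₃ε₁` (so `O₁ := 1`), `a″₁ := min` of the two `a′₁`, the two `e₆/(L³B₃)` (window) and the sibling's admissibility bound; then `existenceMinimalOrbit_of_interior_allL`.

HONEST FRAMING.  Glue only; PLAQ and DIV are the analytic content (KKT∕halving species, [Balaban1985Variational] Sect. F (158)–(165) with a sign) and stay hypotheses; nothing of
print asserted; no stub∕crux∕count moves; YM₃ on T³ is ladder rung R3 — not d = 4, not a mass gap, not Clay.

References: T. Bałaban, CMP **102** (1985) 277–309 [Balaban1985Variational] ((2)–(8) p.278, (14) p.280, Prop. 7 p.299, Sect. F (158)–(165) pp.302–304).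
-/

set_option autoImplicit false

noncomputable section

namespace Summit.QuantumFields.YangMills.Theorems.Prop7ClosedFibreMinimiser

open Set
open scoped Matrix.Norms.L2Operator
open Literature.MathematicalPhysics.QuantumFieldTheory.Balaban1983to89
open Literature.MathematicalPhysics.QuantumFieldTheory.Balaban1983to89.T3ContinuumYM3Torus
open Literature.MathematicalPhysics.QuantumFieldTheory.Balaban1983to89.T3UnitLawDensityEML (ℰp)
open Literature.MathematicalPhysics.QuantumFieldTheory.Balaban1983to89.T3PrintedRegularMinimiser (RegPr DivSmall regFibrePr)
open Literature.MathematicalPhysics.QuantumFieldTheory.Balaban1983to89.T3RegularMinimiser (regThreshold)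
open Literature.MathematicalPhysics.QuantumFieldTheory.Balaban1983to89.T3ConstrainedMinimiser (fibre)
open Literature.MathematicalPhysics.QuantumFieldTheory.Balaban1983to89.T3TiltDescent (descendTo)
open Literature.MathematicalPhysics.QuantumFieldTheory.Balaban1983to89.B10Eq27TorusAxialLog (toUField unitsField)
open Literature.MathematicalPhysics.QuantumFieldTheory.Balaban1983to89.B10Eq68TorusRegularity (covDivT)

/-! ## §1 One radius: PLAQ ∧ DIV ⇒ the interiority conclusion -/

/-- **INTERIOR = PLAQUETTE HALF ∧ DIVERGENCE HALF** (one member, one radius; `𝔘_k(e)` is the conjunction of the two strict clauses of (2)). [cite: Balaban1985Variational, (2) p.278] -/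
theorem regPr_of_plaqHalf_divHalf (F : T3Family) {n K : ℕ} {e : ℝ} {Ū : GaugeField (F.P K) 0 (Matrix.specialUnitaryGroup (Fin 2) ℂ)}
    (hP : PlaqSmall (regThreshold F n K e) Ū) (hD : DivSmall F n K e Ū) : RegPr F n K e Ū :=
  ⟨hP, hD⟩

/-! ## §2 ★★ EX from the two halves on a window, at `O₁ = 1` -/

/-- ★★ **v10's `stub_existenceMinimalOrbit` ⇐ PLAQ_allL ∧ DIV_allL.**  For every `L > 1`, `B₃ > 4`, the PLAQUETTE half and the DIVERGENCE half of the interiority sentence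
on a radius window `L³B₃ε₁ ≤ e ≤ e₆` (each with its own `e₆ > 0`, `a′₁ > 0`) give Prop. 7's existence clause from a background in the registered member-uniform shape, with
`O₁ = 1`: read both at `e := L³B₃ε₁`, shrink `a′₁` to fit both windows, conclude `RegPr (L³B₃ε₁) Ū` (§1) and apply the sibling's `existenceMinimalOrbit_of_interior_allL`.
[cite: Balaban1985Variational, Prop. 7 p.299, (14) p.280, Sect. F (158)-(165) pp.302-304] -/
theorem existenceMinimalOrbit_of_plaqHalf_divHalf_allL
    (hP : ∀ L : ℕ, 1 < L → ∀ B₃ : ℝ, 4 < B₃ → ∃ e₆ a₁' : ℝ, 0 < e₆ ∧ 0 < a₁' ∧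
      ∀ F : T3Family, F.L = L → ∀ (n K : ℕ) (hnK : n < K) (ε₁ : ℝ), 0 < ε₁ → ε₁ ≤ a₁' → ∀ e : ℝ, (L : ℝ) ^ 3 * B₃ * ε₁ ≤ e → e ≤ e₆ →
        ∀ V : GaugeField (F.P n) 0 (Matrix.specialUnitaryGroup (Fin 2) ℂ), PlaqSmall ε₁ V →
          ∀ U₀ : GaugeField (F.P K) 0 (Matrix.specialUnitaryGroup (Fin 2) ℂ), RegPr F n K ((L : ℝ) ^ 3 * B₃ * ε₁) U₀ →
            U₀ ∈ fibre F ℰp n K hnK.le V →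
            ∀ Ū : GaugeField (F.P K) 0 (Matrix.specialUnitaryGroup (Fin 2) ℂ),
              Ū ∈ {U : GaugeField (F.P K) 0 (Matrix.specialUnitaryGroup (Fin 2) ℂ) | ∀ p : Plaq (F.P K) 0,
                    GaugeGroup.dist1 (GaugeField.plaqHol U p) ≤ regThreshold F n K e} ∩ descendTo F ℰp n K hnK.le ⁻¹' {V} ∩
                  {U | ∀ b : PBond (F.P K) 0, ‖covDivT 1 (unitsField (toUField U)) b.dir b.src‖ ≤ e * ((F.L : ℝ)⁻¹) ^ (3 * (K - n))} →
              IsMinOn (fun W : GaugeField (F.P K) 0 (Matrix.specialUnitaryGroup (Fin 2) ℂ) => wilsonAction4 W)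
                ({U : GaugeField (F.P K) 0 (Matrix.specialUnitaryGroup (Fin 2) ℂ) | ∀ p : Plaq (F.P K) 0,
                    GaugeGroup.dist1 (GaugeField.plaqHol U p) ≤ regThreshold F n K e} ∩ descendTo F ℰp n K hnK.le ⁻¹' {V} ∩
                  {U | ∀ b : PBond (F.P K) 0, ‖covDivT 1 (unitsField (toUField U)) b.dir b.src‖ ≤ e * ((F.L : ℝ)⁻¹) ^ (3 * (K - n))}) Ū →
              PlaqSmall (regThreshold F n K e) Ū)
    (hD : ∀ L : ℕ, 1 < L → ∀ B₃ : ℝ, 4 < B₃ → ∃ e₆ a₁' : ℝ, 0 < e₆ ∧ 0 < a₁' ∧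
      ∀ F : T3Family, F.L = L → ∀ (n K : ℕ) (hnK : n < K) (ε₁ : ℝ), 0 < ε₁ → ε₁ ≤ a₁' → ∀ e : ℝ, (L : ℝ) ^ 3 * B₃ * ε₁ ≤ e → e ≤ e₆ →
        ∀ V : GaugeField (F.P n) 0 (Matrix.specialUnitaryGroup (Fin 2) ℂ), PlaqSmall ε₁ V →
          ∀ U₀ : GaugeField (F.P K) 0 (Matrix.specialUnitaryGroup (Fin 2) ℂ), RegPr F n K ((L : ℝ) ^ 3 * B₃ * ε₁) U₀ →
            U₀ ∈ fibre F ℰp n K hnK.le V →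
            ∀ Ū : GaugeField (F.P K) 0 (Matrix.specialUnitaryGroup (Fin 2) ℂ),
              Ū ∈ {U : GaugeField (F.P K) 0 (Matrix.specialUnitaryGroup (Fin 2) ℂ) | ∀ p : Plaq (F.P K) 0,
                    GaugeGroup.dist1 (GaugeField.plaqHol U p) ≤ regThreshold F n K e} ∩ descendTo F ℰp n K hnK.le ⁻¹' {V} ∩
                  {U | ∀ b : PBond (F.P K) 0, ‖covDivT 1 (unitsField (toUField U)) b.dir b.src‖ ≤ e * ((F.L : ℝ)⁻¹) ^ (3 * (K - n))} →
              IsMinOn (fun W : GaugeField (F.P K) 0 (Matrix.specialUnitaryGroup (Fin 2) ℂ) => wilsonAction4 W)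
                ({U : GaugeField (F.P K) 0 (Matrix.specialUnitaryGroup (Fin 2) ℂ) | ∀ p : Plaq (F.P K) 0,
                    GaugeGroup.dist1 (GaugeField.plaqHol U p) ≤ regThreshold F n K e} ∩ descendTo F ℰp n K hnK.le ⁻¹' {V} ∩
                  {U | ∀ b : PBond (F.P K) 0, ‖covDivT 1 (unitsField (toUField U)) b.dir b.src‖ ≤ e * ((F.L : ℝ)⁻¹) ^ (3 * (K - n))}) Ū →
              DivSmall F n K e Ū) :
    ∀ L : ℕ, 1 < L → ∀ B₃ : ℝ, 4 < B₃ → ∃ a₁' O₁ : ℝ, 0 < a₁' ∧ 1 ≤ O₁ ∧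
      ∀ F : T3Family, F.L = L → ∀ (n K : ℕ) (hnK : n < K) (ε₁ : ℝ), 0 < ε₁ →
        ∀ V : GaugeField (F.P n) 0 (Matrix.specialUnitaryGroup (Fin 2) ℂ), PlaqSmall ε₁ V →
          ∀ U₀ : GaugeField (F.P K) 0 (Matrix.specialUnitaryGroup (Fin 2) ℂ), RegPr F n K ((L : ℝ) ^ 3 * B₃ * ε₁) U₀ →
            U₀ ∈ fibre F ℰp n K hnK.le V → ε₁ ≤ a₁' →
              ∃ U ∈ regFibrePr F n K hnK.le (O₁ * (L : ℝ) ^ 3 * B₃ * ε₁) V,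
                IsMinOn (fun W : GaugeField (F.P K) 0 (Matrix.specialUnitaryGroup (Fin 2) ℂ) => wilsonAction4 W)
                  (regFibrePr F n K hnK.le (O₁ * (L : ℝ) ^ 3 * B₃ * ε₁) V) U := by
  refine existenceMinimalOrbit_of_interior_allL fun L hL B₃ hB₃ => ?_
  obtain ⟨eP, aP, heP, haP, hP⟩ := hP L hL B₃ hB₃
  obtain ⟨eD, aD, heD, haD, hD⟩ := hD L hL B₃ hB₃
  have hLpos : (0 : ℝ) < L := by exact_mod_cast (by omega : 0 < L)
  have hB₃pos : 0 < B₃ := by linarith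
  have hDpos : 0 < (L : ℝ) ^ 3 * B₃ := by positivity
  -- `a″₁ := min (min aP aD) (min eP eD / (L³B₃))`, `O₁ := 1`
  set a₁'' : ℝ := min (min aP aD) (min eP eD / ((L : ℝ) ^ 3 * B₃)) with ha''
  have ha₁'' : 0 < a₁'' := lt_min (lt_min haP haD) (div_pos (lt_min heP heD) hDpos)
  refine ⟨a₁'', 1, ha₁'', le_rfl, fun F hF n K hnK ε₁ hε₁ hε₁a V hV U₀ hreg hfib Ū hŪ hmin => ?_⟩
  have haP' : ε₁ ≤ aP := hε₁a.trans ((min_le_left _ _).trans (min_le_left _ _))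
  have haD' : ε₁ ≤ aD := hε₁a.trans ((min_le_left _ _).trans (min_le_right _ _))
  have hwin : (L : ℝ) ^ 3 * B₃ * ε₁ ≤ min eP eD := by
    have : ε₁ ≤ min eP eD / ((L : ℝ) ^ 3 * B₃) := hε₁a.trans (min_le_right _ _)
    rw [le_div_iff₀ hDpos] at this
    linarith [this]
  have h1 : (1 : ℝ) * (L : ℝ) ^ 3 * B₃ * ε₁ = (L : ℝ) ^ 3 * B₃ * ε₁ := by ring
  rw [h1] at hŪ hmin ⊢
  exact regPr_of_plaqHalf_divHalf F
    (hP F hF n K hnK ε₁ hε₁ haP' _ le_rfl (hwin.trans (min_le_left _ _)) V hV U₀ hreg hfib Ū hŪ hmin)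
    (hD F hF n K hnK ε₁ hε₁ haD' _ le_rfl (hwin.trans (min_le_right _ _)) V hV U₀ hreg hfib Ū hŪ hmin)

end Summit.QuantumFields.YangMills.Theorems.Prop7ClosedFibreMinimiser

end
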